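import Mathlib
import HarnessLib
import HarnessLib.Audit
import Summits.CriticalPhenomena.Statement
import Literature.Probability.Percolation.CardyFormula
import Literature.Probability.Percolation.SeparatingEvents
import HarnessLib.Audit.Status.Attr

/-!
Route: CardyNeumannHarmonic

DORMANT since 2026-08-24T05:05:16Z (reconciler: no traction for 6.6 d (last activity item-evidence-added at 2026-08-17T15:07:43Z); parked, not closed — `ledger route dormant route-CriticalPhenomena-CardyNeumannHarmonic --off` to reactiv) — unstaffed, not closed; items shared with open routes are served there. `ledger route dormant <id> --off` reactivates.

# Route CardyNeumannHarmonic — harmonic separating probabilities plus a symmetry-forced Neumann law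
pin Smirnov's triple on Z2

It suffices to show X = RectilinearHarmonicLimit: on every RECTILINEAR 3-marked Jordan domain (T;
a₀,a₁,a₂) Smirnov's bond-ℤ² separating
probabilities H^δ_α = bondSeparatingProb T α δ converge locally uniformly to his harmonic triple h_α
= 1/3 + (2/3)Re(Φ/s^α) (Φ the conformal
map onto the equilateral triangle (1,s,s²)). X is reached as STATIONARITY of the Dirichlet energy on
Smirnov's boundary class, split into its
two Euler–Lagrange halves: crux InteriorHarmonicity (every subsequential limit G_α is weakly
harmonic — interior stationarity) and crux
EvenReflectionLaw (the natural/Neumann boundary condition ∂ₙ(G_(α+1) − G_(α+2)) = 0 on the flat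
pieces of the arc opposite corner α, in weak
even-reflection form — boundary stationarity). With the ℤ² boundary values G_α = 0 and
G_(α+1)+G_(α+2) = 1 on that arc (support
HolderCompactnessZ2, RSW + self-duality) the mixed problem has the UNIQUE bounded solution h
(support StationaryIdentification); Carleson's
boundary value turns X into Cardy for rectilinear conformal rectangles (support
RectHarmonicToRectCardy) and the PROVED tree item
RectilinearSuffices (stmt-CriticalPhenomena-5663) gives CardyFormulaZ2. No card is realised (lens
controlling-quantity, cycle 2).
Lean: `∀ (T : Literature.Probability.RandomPlanarGeometry.MarkedDomain 3), (∃ S : Finset (ℂ × ℂ), (∀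
p ∈ S, p.1.re = p.2.re ∨ p.1.im = p.2.im) ∧ frontier T.carrier ⊆ ⋃ p ∈ S, segment ℝ p.1 p.2) → ∀ (s
: ℂ), s ^ 3 = 1 → s ≠ 1 → ∀ (Φ : Literature.Probability.RandomPlanarGeometry.ConformalEquiv
T.carrier (interior (convexHull ℝ {(1 : ℂ), s, s ^ 2}))), (∀ i : Fin 3, Φ.HasBoundaryValue (T.pt i)
(s ^ (i : ℕ))) → ∀ α : Fin 3, TendstoLocallyUniformlyOn (fun (δ : ℝ) (z : ℂ) =>
Literature.Probability.Percolation.bondSeparatingProb T α δ z) (fun z : ℂ => 1 / 3 + 2 / 3 * (Φ z /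
s ^ (α : ℕ)).re) (nhdsWithin (0 : ℝ) (Set.Ioi 0)) T.carrier`

## Assembly
Pure composition (sorry-free in Sketch.lean and glue.lean): StationaryIdentification turns the two
cruxes plus HolderCompactnessZ2 into
RectilinearHarmonicLimit; RectHarmonicToRectCardy gives Cardy on rectilinear conformal rectangles;
RectilinearSuffices (proved) gives the
conjunct. closes := fun hH hN hK hS hR hRS ↦ hRS (hR (hS hH hN hK)). The Assembly item records the
same implication (provable now := closes; Sketch.lean checks `assembly_holds`).

Rationale: WHY THIS LINE. Smirnov characterises each h_α by a mixed Dirichlet / OBLIQUE-Neumann problem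
(arXiv:0909.4499 §2 eq. (2); Werner's ORBM(π/3) remark), whose
oblique angle π/3 is conformal-invariance data; the pool's card cr-material-law §(H) dismissed
harmonicity of the ℤ² triple because "harmonic
fake-Cardy worlds exist". The lever here is that the ORTHOGONAL Neumann condition for the DIFFERENCE
G_(α+1) − G_(α+2) is angle-free and has a
lattice mechanism on ℤ² — near a flat boundary point ζ both normal increments equal −K·ρ(ζ)·y + o(y)
with the SAME boundary two-arm germ
constant K (the lattice reflection across the normal line at ζ maps the (α+1)-hull picture onto the
(α+2)-hull picture; germ decoupling à la
Kesten1987Scaling / Nolin2008 / GarbanPeteSchramm2013Pivotal makes K independent of the far arcs)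
and equal tangential landing densities ρ
(the duality sum rule G_(α+1)+G_(α+2) = 1 on the arc) — and that this Neumann law is exactly the
condition the fake-Cardy harmonic worlds
violate: a finite-energy/removable-corner uniqueness argument (AxlerBourdonRamey2001-level harmonic
function theory, imported from elliptic
PDE / calculus of variations: the two cruxes are the interior and the free-boundary Euler–Lagrange
equations of the Dirichlet energy on the
affine class cut out by Smirnov's Dirichlet data, whose unique critical point is h) pins the triple.
Unlike CardyHarmonicInvariants (MoreraOnZ2:
a contour identity for the COMBINATION ΣτʲH_j), CardyDiscreteHolo (two contour conservation laws),
CardyMaterialLaw (autonomy of the CR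
defect) or CardyObliqueExplorer (oblique-walk martingales), no Cauchy–Riemann coupling, colour
switching or model transport is asked for: the
coupling between the three functions enters only through two boundary relations that symmetry and
duality supply, and what is left is
harmonicity of three bounded RSW-Hölder functions, one at a time (numerically the ℤ² triple is
discrete-harmonic to 1e-3 of its energy at
δ = 1/16, card cr-material-law numerics kit j001655–j001657). Restricting to rectilinear domains
makes the reflection an exact lattice
symmetry (no DKKMO2020Rotational input) and lets the proved RectilinearSuffices close.

RANKED CRUXES. #0 RectilinearHarmonicLimit (target) — Smirnov's harmonic conformal invariants (X_H
of route CardyHarmonicInvariants) restricted to rectilinear 3-marked Jordan domains: H^δ_α → 1/3 +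
(2/3)Re(Φ/s^α) locally uniformly on the carrier, for every admissible (s, Φ). (why it might fail: It
is Cardy–Smirnov on rectilinear domains (Schramm Problem 2.11): false iff bond-ℤ² crossing limits
are not conformally invariant / not F (Zhang arXiv:2206.04599 claims so, unrefereed).) [Smirnov2001,
Smirnov2009CriticalPercolation, BollobasRiordan2006, Beffara2008Universal]
#2 InteriorHarmonicity (crux) — for every rectilinear 3-marked Jordan domain T, every mesh sequence
u_n → 0⁺ and every locally uniform limit G = (G_0,G_1,G_2) of (H^(u_n)_α)_α on T.carrier (continuous
there), each G_α is weakly harmonic: ∫ G_α Δφ = 0 for every nonnegative C² test function φ compactly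
supported in T.carrier (equivalently for all signs; equivalently the mean-value property). Interior
Euler–Lagrange equation of the Dirichlet energy; true on 𝕋 by Smirnov's theorem. [difficulty:
open-problem] (why it might fail: Summit-strength given EvenReflectionLaw: harmonicity of H_α is
κ=6-specific (Schramm's SLE₆ passage law is not harmonic; the 3-arc hull is, iff Cardy); the 8
signed three-arm terms of Δ_δH_α must cancel to relative order δ^(4/3) and no ℤ² identity forces
it.) [Smirnov2009CriticalPercolation, Smirnov2001, BollobasRiordan2006, Beffara2008Universal,
ChelkakSmirnov2012, SchrammSmirnov2011]
#3 EvenReflectionLaw (crux) — for every 3-marked Jordan domain T, mesh sequence and continuous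
locally uniform limit G as above, every corner index α, and every ball B(ζ,r) free of marks in which
T.carrier is the open half-ball on the side of an axis-parallel unit normal n (a flat piece of the
arc opposite corner α), the difference W = G_(α+1) − G_(α+2) pairs to zero against the Laplacian of
every nonnegative C² test function supported in B(ζ,r) that is EVEN under the reflection across the
flat line: ∫_T.carrier W Δφ = 0. Equivalently: the even reflection of W across the piece is harmonic
on the ball, i.e. W is harmonic up to the piece with homogeneous Neumann data (boundary
Euler–Lagrange equation). [difficulty: XL] (why it might fail: Needs boundary two-arm GERM
DECOUPLING for the extremal-crossing hull near its landing point, uniformly along the piece, incl.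
pockets/multiple touchings at o(y); unwritten on ℤ² (GPS13-type coupling is for interior 4-arm
points); plus harmonicity of W in the layer (rank-2 type).) [Kesten1987Scaling, Nolin2008,
GarbanPeteSchramm2013Pivotal, Smirnov2009CriticalPercolation, Grimmett1999, Werner2007]
#9 HolderCompactnessZ2 (support) — verbatim CardyHarmonicInvariants.HolderCompactnessZ2
(stmt-CriticalPhenomena-0799): uniform Hölder equicontinuity of H^δ_α on compacts (RSW) and the
boundary values G_α → 0, G_(α+1)+G_(α+2) → 1 at inner points of the arc opposite α (self-duality).
Shared item. [difficulty: L] [Smirnov2001, BollobasRiordan2006, Grimmett1999, Werner2007]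
#9 StationaryIdentification (support) — free-boundary uniqueness: InteriorHarmonicity →
EvenReflectionLaw → HolderCompactnessZ2 → RectilinearHarmonicLimit. Proof plan: Arzelà–Ascoli on an
exhaustion (equicontinuity) gives continuous sublimits G along any u_n; weak harmonicity ⇒ harmonic
(Weyl); HolderCompactnessZ2(ii) gives G_α = 0 and G_(α+1)+G_(α+2) = 1 on the open arcs;
EvenReflectionLaw ⇒ W_α reflects evenly to a harmonic function across every flat piece; S := ΣG_β is
bounded harmonic with boundary value 1 off the three marks ⇒ S ≡ 1; d := G − h (h Smirnov's triple
for the given (s,Φ), which satisfies the same data: h_α = 0, h_(α+1)+h_(α+2) = 1, ∂ₙ(h_(α+1) −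
h_(α+2)) = 0 since ∇ of that difference is tangent to the image side) is bounded harmonic with
homogeneous mixed data; at polygon corners and at the marks boundedness makes the singularity
removable (no zero angular mode: the constant solutions of the corner problem vanish), so d has
finite energy and Green's identity Σ_β∫|∇d_β|² = Σ_arcs ∫ d_β ∂ₙ d_β = 0 (on the arc opposite α: d_α
= 0 and d_(α+1)∂ₙd_(α+1) + d_(α+2)∂ₙd_(α+2) = d_(α+1)∂ₙ(d_(α+1) − d_(α+2)) = 0); hence d ≡ 0,
sublimits are unique and the full family converges along 𝓝[>]0. [difficulty: L]
[AxlerBourdonRamey2001, Smirnov2009CriticalPercolation, BollobasRiordan2006, PommerenkeBBCM1992]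
#9 RectHarmonicToRectCardy (support) — Carleson's boundary value on rectilinear conformal
rectangles: RectilinearHarmonicLimit → Cardy's formula (HasCrossingLimit … cardyFunction) for every
conformal rectangle whose frontier lies in finitely many axis-parallel segments. Proof plan: R = (Ω;
a,b,c,d) rectilinear, T = forgetLast R, Carleson map ψ onto an equilateral triangle
(exists_isCarlesonMap_holds), Φ = affine ∘ ψ; |P[(ab)_δ ↔ (cd)_δ] − H^δ_0(z)| ≤ C|z − d|^c + o(1)
for z near d (one-arm RSW at the mark, as in CardyHarmonicInvariants.HarmonicToTriangleForm);
h_0(d⁻) = carlesonRatio = cardyFunction(crossRatio x) by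
cardyFunction_crossRatio_eq_carlesonRatio_holds for any uniformizing datum. [difficulty: M]
[Smirnov2001, BollobasRiordan2006, Werner2007, Grimmett1999]
#9 RectilinearSuffices (support) — verbatim CardyBoundaryCoulombGas.RectilinearSuffices
(stmt-CriticalPhenomena-5663, PROVED in tree by Theorems.RectilinearSuffices_proof): Cardy for
rectilinear conformal rectangles implies CardyFormulaZ2 (inner/outer rectilinear sandwich,
monotonicity, RSW at the marks, continuity of F and of the cross-ratio). [difficulty: provable-now]
[Smirnov2001, CamiaNewman2007, Grimmett1999]

TWO-LAYER PLAN. EvenReflectionLaw ⇐ NormalIncrementGerm (lattice o(y) law for the normal increments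
of H_(α+1) − H_(α+2) in the layer y..2y above a flat
piece: duality sum rule + lattice reflection + boundary two-arm germ decoupling) → LayerHarmonicity
(weak harmonicity of W against tests
inside the carrier, = InteriorHarmonicity for differences) → IncrementsToReflection (pure analysis:
Green's identity in the layer) →
EvenReflectionLaw (birth skeleton bc/EvenReflectionLaw_birth.lean, mechanism form).
InteriorHarmonicity ⇐ WeakSubharmonic → WeakSuperharmonic
→ InteriorHarmonicity (Chelkak–Smirnov-type one-sided sandwich; birth skeleton
bc/InteriorHarmonicity_birth.lean); alternative split by
Σ_βG_β harmonic (weak BondSumRule) + pairwise differences harmonic. Nothing filed now.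

KILL CRITERIA. ¬EvenReflectionLaw numerically robust (normal increments of H_(α+1), H_(α+2) above an
off-centre boundary point of a rectilinear domain differ
at first order in y, persisting under refinement) kills the decomposition — close
`refuted:EvenReflectionLaw` (the uniqueness lemma then
says nothing). ¬InteriorHarmonicity with EvenReflectionLaw proved is ¬Cardy on ℤ² (refutes the
conjunct; hand to the negatives index). X_H /
MoreraOnZ2 (CardyHarmonicInvariants) or RectilinearCardy (CardyBoundaryCoulombGas) proved elsewhere
supersedes the route.

NOT DECOMPOSED YET. The germ-decoupling lemma behind EvenReflectionLaw (boundary two-arm coupling,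
pockets, uniformity along the piece); the removable-corner
/ finite-energy lemma and the Weyl lemma inside StationaryIdentification; continuity of sublimits
from asymptotic equicontinuity; the
one-arm link at the fourth mark inside RectHarmonicToRectCardy; general (non-rectilinear) domains
and DKKMO — deliberately excluded by
RectilinearSuffices.

CHEAPEST FALSIFIER. Monte-Carlo of the lattice Neumann law: bond-ℤ² square [0,n]², marks b=(0,0),
c=(n,0), a=(0,n) (asymmetric), flat piece = bottom side,
points w = (n/4, 0), (3n/4, 0); compare D_b(y) = H_b(w+2y i) − H_b(w+y i) with D_c(y) for y = 2..8
at n = 64, 128 (hull indicators of all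
grid points come from one union-find + biconnected-component pass per sample, as in card
cr-material-law's mc_cardy_qr.py): prediction
|D_b − D_c| / |D_b + D_c| = O(y/n) → 0, versus O(1) if the law fails. Not run here (farm saturated:
80 queued / 52 running at session start;
one batched kit job is the refuter's first move). Theory-cheap check done here: in the Cardy world
∂ₙh_(α+1) = ∂ₙh_(α+2) = −1/3 and
∂ₜh_(α+1) = −∂ₜh_(α+2) = 1/√3 on the side opposite α of the unit triangle (oblique angle π/3 =
Smirnov's (2)), so EvenReflectionLaw and the
uniqueness lemma are consistent with eq. (2) of arXiv:0909.4499.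

NUMBERS. Card cr-material-law numerics (bond-ℤ² backbone triple, 3·10⁵ samples): total
Dirichlet-energy excess over the conformal value 0.17 (n=8) →
0.12 (12) → 0.093 (16) ≈ δ^0.9, ANHARMONIC (interior) part ≤ 3.5·10⁻⁴ — the finite-mesh triple is
discrete-harmonic to four digits and the
whole excess is boundary-law (Douglas) deficit, i.e. the finite-δ violation of the Neumann law,
decaying like δ^0.9. BondSumRule MC at a
triangle centre: 1.026(22) at n=128 (stmt-8934 note). Exponents used: boundary two-arm = 1 and
three-arm = 2, five-arm = 2 (universal, ℤ²).
Items at open: 8 (2 cruxes).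

DEFINITION REQUESTS. None: bondSeparatingProb (SeparatingEvents), MarkedDomain.arc/pt,
ConformalEquiv.HasBoundaryValue, Laplacian.laplacian (Mathlib),
cardyFunction, HasCrossingLimit exist. A later convenience: `IsRectilinear (D : JordanDomain)` for
the inlined finite-axis-parallel-segments clause.

Novelty: Searches (2026-08-17): `lit search --hybrid "Cardy formula harmonic conformal invariants mixed
Dirichlet Neumann boundary value problem equilateral triangle"` (8; hit 1 = arXiv:0909.4499 pp.4–5,
the rest PDE textbooks); `lit galaxy search "mixed Dirichlet-Neumann problem percolation crossing"
--star all` (0/0/0); `lit galaxy search "harmonic conformal invariants percolation square lattice"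
--star all` (0/0/0); `lit galaxy search "harmonic conformal invariants" --star all` (0/0/0); `lit
galaxy search "obliquely reflected Brownian" --star all` (3 pdf: Franceschi et al., wedge RBM —
unrelated); `lit search --source arxiv "Cardy formula bond percolation square lattice"` (4:
arXiv:1112.2017 Tsai–Yam–Zhou, cond-mat/9802082, arXiv:0708.3908 Beffara, cond-mat/0207359 Turban);
`lit frontier CriticalPhenomena --since 2024` (40 rows; nearest arXiv:2605.04395 anchored random
clusters, arXiv:2603.28161 CLE boundary 4-point connectivities — continuum side only); grep of all
56 Theses and 171 cards of the sub for "Neumann" (hits: USTContinuation discrete modulus,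
PivotalEnergyLaw extremal potential, card mean-interface-current (log-pole Neumann profile) — none
on the separating triple); `lean search` for the four new decl names (0).
Nearest prior art found: arXiv:0909.4499 §2 eq. (2) (Smirnov: each h_α is the unique solution of a
mixed Dirichlet / OBLIQUE-Neumann problem, angle π/3; Werner's ORBM remark) and, in the pool, card
cr-material-law §(A′)/(H) (energy/Douglas identity; harmonic sho  [refs: 0909.4499, 1112.2017, 0708.3908, 2605.04395, 2603.28161]

Barriers (technique_class: free-boundary-harmonic, neumann-uniqueness, two-arm-germ): - technique_class: free-boundary-harmonic, neumann-uniqueness, two-arm-germ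
- Literature.Barriers.CriticalPhenomena.SmirnovTriangularOnly: evaded — no colour-switching / 2π/3
lattice turn is used anywhere; the only lattice symmetry invoked is the axis reflection of ℤ²
(EvenReflectionLaw) and self-duality at p = 1/2 (HolderCompactnessZ2).
- Literature.Barriers.CriticalPhenomena.EmbeddingModulusUniqueness: respected, not evaded by a trick
— EvenReflectionLaw uses the exact mirror symmetry of the SQUARE embedding (a sheared lattice has no
reflection across the normal line, and indeed its limit h∘L violates the orthogonal Neumann law), so
the argument is embedding-sensitive exactly where Beffara's Prop. 4 demands; InteriorHarmonicity is
where the isotropy of ℤ² must bite and no mechanism is claimed: the bet is that harmonicity of one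
bounded function is a smaller target than holomorphicity of the triple.
- Literature.Barriers.CriticalPhenomena.FKParafermionicHalfCauchyRiemann: applies in spirit to
InteriorHarmonicity (harmonicity of H_α = irrotationality of the mean normal current of its hull,
'missing-half'-type information); it does not touch EvenReflectionLaw or the uniqueness lemma, which
are boundary statements with their own mechanism.
- Literature.Barriers.CriticalPhenomena.CoveringLatticeShift: not used (no site interpolation).
- Literature.Barriers.CriticalPhenomena.LongRangeTrivialityOnZ3: not applicable — an
Ising3DConformalLimit barrier (interaction-uniform / bubble-b

History (route lifecycle, newest last):
- 2026-08-24T05:05:16Z · DORMANT — reconciler: no traction for 6.6 d (last activity item-evidence-added at 2026-08-17T15:07:43Z); parked, not closed — `ledger route dormant route-CriticalPhenomen (operator:999:3100362)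

sub-problem: CardyFormulaZ2 · status: dormant · opened planner-plan-lens3-CriticalPhenomena-control-g2-0 2026-08-17T03:07:58Z · rev 1 · ledger route-CriticalPhenomena-CardyNeumannHarmonic
GENERATED by the gate from the ledger (D-0016/17). Provers cite these decls: `theorem foo : Summit.CriticalPhenomena.CardyFormulaZ2.Theses.CardyNeumannHarmonic.<Decl> := …` in Summits/CriticalPhenomena/CardyFormulaZ2/Theorems/<Name>.lean.
-/

namespace Summit.CriticalPhenomena.CardyFormulaZ2.Theses.CardyNeumannHarmonic

open scoped BigOperators Topology Manifold Classical MeasureTheory ProbabilityTheory Matrix InnerProductSpace ComplexConjugate ContinuousMap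
open Filter Set Function TopologicalSpace MeasureTheory

attribute [summit_statement] _root_.CardyFormulaZ2

/-- item stmt-CriticalPhenomena-18932 · target · rank 0 · open · by planner
why it might fail: It is Cardy–Smirnov on rectilinear domains (Schramm Problem 2.11): false iff bond-ℤ² crossing limits are not conformally invariant / not F (Zhang arXiv:2206.04599 claims so, unrefereed).
sources: Smirnov2001, Smirnov2009CriticalPercolation, BollobasRiordan2006, Beffara2008Universal
[target] Smirnov's harmonic conformal invariants (X_H of route CardyHarmonicInvariants) restricted
to rectilinear 3-marked Jordan domains: H^δ_α → 1/3 + (2/3)Re(Φ/s^α) locally uniformly on the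
carrier, for every admissible (s, Φ). -/
@[route_item "route-CriticalPhenomena-CardyNeumannHarmonic"]
def RectilinearHarmonicLimit : Prop :=
  ∀ (T : Literature.Probability.RandomPlanarGeometry.MarkedDomain 3), (∃ S : Finset (ℂ × ℂ), (∀ p ∈ S, p.1.re = p.2.re ∨ p.1.im = p.2.im) ∧ frontier T.carrier ⊆ ⋃ p ∈ S, segment ℝ p.1 p.2) → ∀ (s : ℂ), s ^ 3 = 1 → s ≠ 1 → ∀ (Φ : Literature.Probability.RandomPlanarGeometry.ConformalEquiv T.carrier (interior (convexHull ℝ {(1 : ℂ), s, s ^ 2}))), (∀ i : Fin 3, Φ.HasBoundaryValue (T.pt i) (s ^ (i : ℕ))) → ∀ α : Fin 3, TendstoLocallyUniformlyOn (fun (δ : ℝ) (z : ℂ) => Literature.Probability.Percolation.bondSeparatingProb T α δ z) (fun z : ℂ => 1 / 3 + 2 / 3 * (Φ z / s ^ (α : ℕ)).re) (nhdsWithin (0 : ℝ) (Set.Ioi 0)) T.carrier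

/-- item stmt-CriticalPhenomena-18933 · crux · rank 2 · open · by planner
why it might fail: Summit-strength given EvenReflectionLaw: harmonicity of H_α is κ=6-specific (Schramm's SLE₆ passage law is not harmonic; the 3-arc hull is, iff Cardy); the 8 signed three-arm terms of Δ_δH_α must cancel to relative order δ^(4/3) and no ℤ² identity forces it.
sources: Smirnov2009CriticalPercolation, Smirnov2001, BollobasRiordan2006, Beffara2008Universal, ChelkakSmirnov2012, SchrammSmirnov2011
[crux] for every rectilinear 3-marked Jordan domain T, every mesh sequence u_n → 0⁺ and every
locally uniform limit G = (G_0,G_1,G_2) of (H^(u_n)_α)_α on T.carrier (continuous there), each G_α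
is weakly harmonic: ∫ G_α Δφ = 0 for every nonnegative C² test function φ compactly supported in
T.carrier (equivalently for all signs; equivalently the mean-value property). Interior
Euler–Lagrange equation of the Dirichlet energy; true on 𝕋 by Smirnov's theorem. [difficulty:
open-problem] -/
@[route_item "route-CriticalPhenomena-CardyNeumannHarmonic", crux]
def InteriorHarmonicity : Prop :=
  ∀ (T : Literature.Probability.RandomPlanarGeometry.MarkedDomain 3), (∃ S : Finset (ℂ × ℂ), (∀ p ∈ S, p.1.re = p.2.re ∨ p.1.im = p.2.im) ∧ frontier T.carrier ⊆ ⋃ p ∈ S, segment ℝ p.1 p.2) → ∀ (u : ℕ → ℝ) (G : Fin 3 → ℂ → ℝ), (∀ n, 0 < u n) → Filter.Tendsto u Filter.atTop (nhds 0) → (∀ α : Fin 3, TendstoLocallyUniformlyOn (fun (n : ℕ) (z : ℂ) => Literature.Probability.Percolation.bondSeparatingProb T α (u n) z) (G α) Filter.atTop T.carrier) → (∀ α : Fin 3, ContinuousOn (G α) T.carrier) → ∀ (α : Fin 3) (φ : ℂ → ℝ), ContDiff ℝ 2 φ → HasCompactSupport φ → tsupport φ ⊆ T.carrier → (∀ z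 : ℂ, 0 ≤ φ z) → ∫ z, G α z * (Laplacian.laplacian φ : ℂ → ℝ) z = 0

/-- item stmt-CriticalPhenomena-18934 · crux · rank 3 · open · by planner
why it might fail: Needs boundary two-arm GERM DECOUPLING for the extremal-crossing hull near its landing point, uniformly along the piece, incl. pockets/multiple touchings at o(y); unwritten on ℤ² (GPS13-type coupling is for interior 4-arm points); plus harmonicity of W in the layer (rank-2 type).
sources: Kesten1987Scaling, Nolin2008, GarbanPeteSchramm2013Pivotal, Smirnov2009CriticalPercolation, Grimmett1999, Werner2007
[crux] for every 3-marked Jordan domain T, mesh sequence and continuous locally uniform limit G as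
above, every corner index α, and every ball B(ζ,r) free of marks in which T.carrier is the open
half-ball on the side of an axis-parallel unit normal n (a flat piece of the arc opposite corner α),
the difference W = G_(α+1) − G_(α+2) pairs to zero against the Laplacian of every nonnegative C²
test function supported in B(ζ,r) that is EVEN under the reflection across the flat line:
∫_T.carrier W Δφ = 0. Equivalently: the even reflection of W across the piece is harmonic on the
ball, i.e. W is harmonic up to the piece with homogeneous Neumann data (boundary Euler–Lagrange
equation). [difficulty: XL] -/
@[route_item "route-CriticalPhenomena-CardyNeumannHarmonic", crux]
def EvenReflectionLaw : Prop :=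
  ∀ (T : Literature.Probability.RandomPlanarGeometry.MarkedDomain 3) (u : ℕ → ℝ) (G : Fin 3 → ℂ → ℝ), (∀ n, 0 < u n) → Filter.Tendsto u Filter.atTop (nhds 0) → (∀ α : Fin 3, TendstoLocallyUniformlyOn (fun (n : ℕ) (z : ℂ) => Literature.Probability.Percolation.bondSeparatingProb T α (u n) z) (G α) Filter.atTop T.carrier) → (∀ α : Fin 3, ContinuousOn (G α) T.carrier) → ∀ (α : Fin 3) (ζ n : ℂ) (r : ℝ), (n = 1 ∨ n = -1 ∨ n = Complex.I ∨ n = -Complex.I) → 0 < r → T.carrier ∩ Metric.ball ζ r = {z | z ∈ Metric.ball ζ r ∧ 0 < ((z - ζ) * (starRingEnd ℂ) n).re} → Metric.ball ζ r ∩ frontier T.carrier ⊆ T.arc (α + 1) → (∀ i : Fin 3, T.pt i ∉ Metric.ball ζ r) → ∀ (φ : ℂ → ℝ), ContDiff ℝ 2 φ → HasCompactSupport φ → tsupport φ ⊆ Metric.ball ζ r → (∀ z : ℂ, φ (z - 2 * ((((z - ζ) * (starRingEnd ℂ) n).re : ℝ) : ℂ) * n) = φ z) → (∀ z : ℂ,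 0 ≤ φ z) → ∫ z in T.carrier, (G (α + 1) z - G (α + 2) z) * (Laplacian.laplacian φ : ℂ → ℝ) z = 0

/-- item stmt-CriticalPhenomena-0799 · support · rank 9 · open · by planner
sources: Smirnov2001, BollobasRiordan2006, Grimmett1999, Werner2007
[support] (informal until bondSeparatingProb lands) A-priori estimates for the Z^2 separating
probabilities: (i) uniform Hölder continuity of H^δ_α on compacts of Ω̄, uniformly in δ ≤ δ_0 (RSW
rsw_half + FKG annuli), hence precompactness in C(Ω̄); (ii) boundary values: H^δ_α → 1 at α, H^δ_α →
0 uniformly on the arc opposite α, and H^δ_a + H^δ_b ≥ 1 − o(1)-type complementary relations on the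
arc (ab) from self-duality of bond-Z^2 at p = 1/2 (dualConfig, bondPercolation_map_dualConfig).
Smirnov2001 §2-3 steps that transplant verbatim; expected provable now. -/
@[route_item "route-CriticalPhenomena-CardyNeumannHarmonic", crux]
def HolderCompactnessZ2 : Prop :=
  ∀ (T : Literature.Probability.RandomPlanarGeometry.MarkedDomain 3) (α : Fin 3), (∀ K : Set ℂ, IsCompact K → K ⊆ T.carrier → ∃ C ε δ₀ : ℝ, 0 < ε ∧ 0 < δ₀ ∧ ∀ δ ∈ Set.Ioo (0 : ℝ) δ₀, ∀ z ∈ K, ∀ w ∈ K, |Literature.Probability.Percolation.bondSeparatingProb T α δ z - Literature.Probability.Percolation.bondSeparatingProb T α δ w| ≤ C * (max ‖z - w‖ δ) ^ ε) ∧ (∀ q ∈ T.arc (α + 1), q ≠ T.pt (α + 1) → q ≠ T.pt (α + 2) → ∀ η : ℝ, 0 < η → ∃ r : ℝ, 0 < r ∧ ∀ z ∈ T.carrier ∩ Metric.ball q r, ∀ᶠ δ : ℝ in nhdsWithin (0 : ℝ) (Set.Ioi 0), Literature.Probability.Percolation.bondSeparatingProb T α δ z ≤ η ∧ |Literature.Probability.Percolation.bondSeparatingProb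 T (α + 1) δ z + Literature.Probability.Percolation.bondSeparatingProb T (α + 2) δ z - 1| ≤ η)

/-- item stmt-CriticalPhenomena-16791 · support · rank 9 · open · by planner
sources: Smirnov2001, CamiaNewman2007, Grimmett1999
[support] Cardy for rectilinear conformal rectangles implies the conjunct — verbatim
stmt-CriticalPhenomena-5663 of route CardyBoundaryCoulombGas, PROVED 2026-08-16
(Theorems.CardyBoundaryCoulombGasAssembly.RectilinearSuffices_proof, Bollobás–Riordan sandwich);
re-asked here so that `closes` may use it. [difficulty: provable-now] -/
@[route_item "route-CriticalPhenomena-CardyNeumannHarmonic", crux]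
def RectilinearSuffices : Prop :=
  (∀ R : Literature.Probability.RandomPlanarGeometry.ConformalRectangle, (∃ S : Finset (ℂ × ℂ), (∀ p ∈ S, p.1.re = p.2.re ∨ p.1.im = p.2.im) ∧ frontier R.carrier ⊆ ⋃ p ∈ S, segment ℝ p.1 p.2) → R.HasCrossingLimit (Literature.Probability.Percolation.bondDomainCrossingProb R) Literature.Probability.RandomPlanarGeometry.cardyFunction) → CardyFormulaZ2

/-- item stmt-CriticalPhenomena-18935 · support · rank 9 · open · by planner
sources: AxlerBourdonRamey2001, Smirnov2009CriticalPercolation, BollobasRiordan2006, PommerenkeBBCM1992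
[support] free-boundary uniqueness: InteriorHarmonicity → EvenReflectionLaw → HolderCompactnessZ2 →
RectilinearHarmonicLimit. Proof plan: Arzelà–Ascoli on an exhaustion (equicontinuity) gives
continuous sublimits G along any u_n; weak harmonicity ⇒ harmonic (Weyl); HolderCompactnessZ2(ii)
gives G_α = 0 and G_(α+1)+G_(α+2) = 1 on the open arcs; EvenReflectionLaw ⇒ W_α reflects evenly to a
harmonic function across every flat piece; S := ΣG_β is bounded harmonic with boundary value 1 off
the three marks ⇒ S ≡ 1; d := G − h (h Smirnov's triple for the given (s,Φ), which satisfies the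
same data: h_α = 0, h_(α+1)+h_(α+2) = 1, ∂ₙ(h_(α+1) − h_(α+2)) = 0 since ∇ of that difference is
tangent to the image side) is bounded harmonic with homogeneous mixed data; at polygon corners and
at the marks boundedness makes the singularity removable (no zero angular mode: the constant
solutions of the corner problem vanish), so d has finite energy and Green's identity Σ_β∫|∇d_β|² =
Σ_arcs ∫ d_β ∂ₙ d_β = 0 (on the arc opposite α: d_α = 0 and d_(α+1)∂ₙd_(α+1) + d_(α+2)∂ₙd_(α+2) =
d_(α+1)∂ₙ(d_(α+1) − d_(α+2)) = 0); hence d ≡ 0, sublimits are unique and the full family converges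
along 𝓝[>]0. [difficulty: L] -/
@[route_item "route-CriticalPhenomena-CardyNeumannHarmonic", crux]
def StationaryIdentification : Prop :=
  InteriorHarmonicity → EvenReflectionLaw → HolderCompactnessZ2 → RectilinearHarmonicLimit

/-- item stmt-CriticalPhenomena-18936 · support · rank 9 · open · by planner
sources: Smirnov2001, BollobasRiordan2006, Werner2007, Grimmett1999
[support] Carleson's boundary value on rectilinear conformal rectangles: RectilinearHarmonicLimit →
Cardy's formula (HasCrossingLimit … cardyFunction) for every conformal rectangle whose frontier lies
in finitely many axis-parallel segments. Proof plan: R = (Ω; a,b,c,d) rectilinear, T = forgetLast R,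
Carleson map ψ onto an equilateral triangle (exists_isCarlesonMap_holds), Φ = affine ∘ ψ; |P[(ab)_δ
↔ (cd)_δ] − H^δ_0(z)| ≤ C|z − d|^c + o(1) for z near d (one-arm RSW at the mark, as in
CardyHarmonicInvariants.HarmonicToTriangleForm); h_0(d⁻) = carlesonRatio = cardyFunction(crossRatio
x) by cardyFunction_crossRatio_eq_carlesonRatio_holds for any uniformizing datum. [difficulty: M] -/
@[route_item "route-CriticalPhenomena-CardyNeumannHarmonic", crux]
def RectHarmonicToRectCardy : Prop :=
  RectilinearHarmonicLimit → ∀ R : Literature.Probability.RandomPlanarGeometry.ConformalRectangle, (∃ S : Finset (ℂ × ℂ), (∀ p ∈ S, p.1.re = p.2.re ∨ p.1.im = p.2.im) ∧ frontier R.carrier ⊆ ⋃ p ∈ S, segment ℝ p.1 p.2) → R.HasCrossingLimit (Literature.Probability.Percolation.bondDomainCrossingProb R) Literature.Probability.RandomPlanarGeometry.cardyFunction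

/-- item stmt-CriticalPhenomena-18937 · assembly · rank 1 · open · by planner
sources: Smirnov2001, BollobasRiordan2006
[assembly] InteriorHarmonicity → EvenReflectionLaw → HolderCompactnessZ2 → StationaryIdentification
→ RectHarmonicToRectCardy → RectilinearSuffices → CardyFormulaZ2. -/
@[route_item "route-CriticalPhenomena-CardyNeumannHarmonic"]
def Assembly : Prop :=
  InteriorHarmonicity → EvenReflectionLaw → HolderCompactnessZ2 → StationaryIdentification → RectHarmonicToRectCardy → RectilinearSuffices → CardyFormulaZ2

/-! D-0027 §2.1 — DECIDING THEOREM (planner-authored via `route open/edit --closes-file`; by planner-plan-lens3-CriticalPhenomena-control-g2-0 2026-08-17T03:07:58Z):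
its hypotheses are this route's items and its conclusion the sub-problem Statement (glue_lint), and it elaborates with this file. -/

@[closes "route-CriticalPhenomena-CardyNeumannHarmonic"] theorem closes (hH : InteriorHarmonicity) (hN : EvenReflectionLaw) (hK : HolderCompactnessZ2)
    (hS : StationaryIdentification) (hR : RectHarmonicToRectCardy) (hRS : RectilinearSuffices) :
    _root_.CardyFormulaZ2 :=
  hRS (hR (hS hH hN hK))

end Summit.CriticalPhenomena.CardyFormulaZ2.Theses.CardyNeumannHarmonic
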